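import Literature.Geometry.Kaehler.ComplexTorusHodgeLieAlgebraRatForm
import Literature.Geometry.Kaehler.ComplexTorusEllipticCurveHodgeLieAlgebra
import Literature.Geometry.Kaehler.ComplexTorusHomRankEquality
import HarnessLib

/-!
# The Hodge Lie algebra over `ℚ` of an elliptic curve: `𝒜(E) = 𝔰𝔩₂(ℚ)` without complex multiplication,
# `𝒜(E) = {a ∈ K | tr a = 0}` (the trace-zero part of the CM field `K = End⁰(E)`, `dim_ℚ = 1`) with complex
# multiplication; and `Hg(X) = SL(V) ⟹ 𝒜 = 𝔰𝔩(V)` for every complex torus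

Layer `Literature/Geometry/Kaehler`, namespace `Literature.Geometry.Kaehler.ComplexTorus`; lane `lit-hodgefound`
(Track 2 foundations library), Layer A4; prover seat `lit-hodgefound-p36` (generation 18, self-proposed row g18-#9: the first
explicit computation of Q2990's `𝒜 = hodgeGroupLieRat Φ`, validating §6 «`𝒜 ⊆ End⁰(X)` ⟺ `X` of CM type» at `g = 1`).
THEOREMS ONLY — no definition, no named fact, net debt 0; everything BY NAME from p17's real statements
(`hodgeGroupLie_eq_sl_of_hodgeGroup_eq_top`, `mem_hodgeGroupLie_ellipticPeriod_iff_of_ne_bot`: `𝔥𝔤_ℝ(E_τ) = ℝ·J`,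
`finrank_sl`, `mem_sl_iff_trace_eq_zero`), the tree's `hodgeGroup_ellipticPeriod_eq_top_iff`, `mem_endAlgRat_iff`,
`mul_jMatrix_comm_iff_exists_eq_smul_one_add_smul_jMatrix` (the commutant of `J` in dimension one is `ℝ·1 ⊕ ℝ·J`),
`finrank_endAlgRat_ellipticPeriod_of_cm` (`dim_ℚ End⁰(E_τ) = 2`), and Q2990's `mem_hodgeGroupLieRat_iff` /
`trace_eq_zero_of_mem_hodgeGroupLieRat`.

## Sources, verbatim

* [Imai1976HodgeGroups] H. Imai, *On the Hodge groups of some abelian varieties*, Kodai Math. Sem. Rep. 27 (1976), §2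
  (p. 368): «`Hg(E) = SL₂` if `E` is not of CM-type», «`Hg(E)` is a 1-dimensional torus if `E` is of CM-type» (as quoted
  in p17's `ComplexTorusEllipticCurveHodgeLieAlgebra`).
* [MoonenZarhin1999] B. Moonen, Yu. G. Zarhin, *Hodge classes and Tate classes on simple abelian fourfolds* / low
  dimension, §2: Type I(1) «`Hg(X) = Sp(V, φ) ≅ SL_{2,ℚ}`»; Type IV(1,1) «`Hg(X) = 𝕌_F`» (the norm-one torus of the
  imaginary quadratic field `F = End⁰(X)`, whose Lie algebra is the trace-zero subspace of `F`).
* [GreenGriffithsKerr2012] M. Green, P. Griffiths, M. Kerr, *Mumford–Tate Groups and Domains*, §II.C, Lemma after (II.C.1)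
  (held p0060): «`𝒜 ⊂ 𝔤` is a Lie sub-algebra defined by the same conditions but where `X ∈ 𝔤`».
* [Lange2023AbelianVarietiesComplex] H. Lange, *Abelian Varieties over the Complex Numbers*, §7.2.3 Prop. 7.2.6 (proof:
  «`T ⊂ End(V)^{Hg(X)} = End_ℚ(X)`»), §5.1.5 Exercise (1) (`End_ℚ(E)` is `ℚ` or an imaginary quadratic field).
* [Humphreys1972] J. E. Humphreys, *Introduction to Lie Algebras and Representation Theory*, §1.2 (`A_ℓ`: dimension
  `(ℓ+1)² - 1`).

## What is here (`𝒜 = hodgeGroupLieRat`, `End⁰ = endAlgRat`, `E_τ = ℂ/(ℤ + τℤ)` via `ellipticPeriod hτ`, `τ ∉ ℝ`)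

* §1 (every complex torus with `Hg(X)(ℝ) = SL(V_ℝ)`): **`hodgeGroupLieRat_eq_sl_of_hodgeGroup_eq_top`** (`𝒜 = 𝔰𝔩_ι(ℚ)`),
  `mem_hodgeGroupLieRat_iff_trace_eq_zero_of_hodgeGroup_eq_top`, `finrank_hodgeGroupLieRat_of_hodgeGroup_eq_top`
  (`dim_ℚ 𝒜 = |ι|² - 1`).
* §2 (`E_τ` WITHOUT CM, `End(E_τ) = ℤ`): **`hodgeGroupLieRat_ellipticPeriod_eq_sl_of_eq_bot`** (`𝒜(E_τ) = 𝔰𝔩₂(ℚ)`),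
  `mem_hodgeGroupLieRat_ellipticPeriod_iff_of_eq_bot` (`A ∈ 𝒜 ⟺ tr A = 0`), `finrank_hodgeGroupLieRat_ellipticPeriod_of_eq_bot`
  (`dim_ℚ 𝒜 = 3`).
* §3 (`E_τ` WITH CM, `K = End⁰(E_τ)` imaginary quadratic): **`mem_hodgeGroupLieRat_ellipticPeriod_iff_of_ne_bot`**
  (`A ∈ 𝒜 ⟺ A ∈ End⁰(E_τ) ∧ tr A = 0`: `𝒜 = K⁰`, the Lie algebra of `𝕌_K`), `coe_hodgeGroupLieRat_ellipticPeriod_eq_of_ne_bot`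
  (`𝒜 = End⁰ ∩ 𝔰𝔩₂(ℚ)`), `coe_hodgeGroupLieRat_ellipticPeriod_subset_endAlgRat_of_ne_bot` (`𝒜 ⊆ End⁰`, the CM case of Q2990 §6),
  **`finrank_hodgeGroupLieRat_ellipticPeriod_of_ne_bot`** (`dim_ℚ 𝒜 = 1`).
* §4 `finrank_hodgeGroupLieRat_ellipticPeriod_eq` (`3` or `1`), **`hodgeGroupLieRat_ellipticPeriod_eq_sl_iff`**
  (`𝒜(E_τ) = 𝔰𝔩₂(ℚ)` ⟺ no CM), `finrank_hodgeGroupLieRat_ellipticPeriod_eq_finrank_hodgeGroupLie` (`dim_ℚ 𝒜 = dim_ℝ 𝔥𝔤_ℝ`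
  at `g = 1`, by the two computations).
-/

noncomputable section

-- Mathlib idiom (`Mathlib/Algebra/Lie/OfAssociative.lean`, as in the imported files): the commutator bracket on
-- `M_ι(ℚ)` / `M_ι(ℝ)` is the non-instance `LieRing.ofAssociativeRing`, enabled file-locally.
attribute [local instance 100] LieRing.ofAssociativeRing

open scoped Matrix
open Set Function Module Matrix

namespace Literature.Geometry.Kaehler

namespace ComplexTorus

/-! ## §1 `Hg(X) = SL(V) ⟹ 𝒜 = 𝔰𝔩(V)` over `ℚ` -/

section SpecialLinearRat

variable {ι : Type*} [Fintype ι] [DecidableEq ι] {E : Type*} [NormedAddCommGroup E] [NormedSpace ℂ E]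
  (Φ : (ι → ℝ) ≃L[ℝ] E)

omit [DecidableEq ι] in
/-- `tr (A ⊗ 1) = tr A`. [folklore] -/
private theorem trace_map_ratCast₉ (A : Matrix ι ι ℚ) : (A.map ((↑) : ℚ → ℝ)).trace = ((A.trace : ℚ) : ℝ) := by
  simp [Matrix.trace, Matrix.map_apply, Rat.cast_sum]

/-- `Hg(X)(ℝ) = SL(V_ℝ) ⟹ (A ∈ 𝒜 ⟺ tr A = 0)` (every such complex torus). [cite: Hall2015, §3.4 Prop. 3.23]
[cite: GreenGriffithsKerr2012, §II.C, Lemma after (II.C.1)] -/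
theorem mem_hodgeGroupLieRat_iff_trace_eq_zero_of_hodgeGroup_eq_top (h : hodgeGroup Φ = ⊤) {A : Matrix ι ι ℚ} :
    A ∈ hodgeGroupLieRat Φ ↔ A.trace = 0 := by
  rw [mem_hodgeGroupLieRat_iff, mem_hodgeGroupLie_iff_trace_eq_zero_of_hodgeGroup_eq_top Φ h, trace_map_ratCast₉,
    Rat.cast_eq_zero]

/-- **`Hg(X)(ℝ) = SL(V_ℝ) ⟹ 𝒜 = 𝔰𝔩_ι(ℚ)`**: the Hodge Lie algebra over `ℚ` of a complex torus with the largest possible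
Hodge group is all of `𝔰𝔩(V)` (p17's `hodgeGroupLie_eq_sl_of_hodgeGroup_eq_top`, rational points).
[cite: Hall2015, §3.4 Prop. 3.23] [cite: GreenGriffithsKerr2012, §II.C, Lemma after (II.C.1)] -/
theorem hodgeGroupLieRat_eq_sl_of_hodgeGroup_eq_top (h : hodgeGroup Φ = ⊤) :
    hodgeGroupLieRat Φ = LieAlgebra.SpecialLinear.sl ι ℚ :=
  SetLike.ext fun _ ↦ by
    rw [mem_hodgeGroupLieRat_iff_trace_eq_zero_of_hodgeGroup_eq_top Φ h, mem_sl_iff_trace_eq_zero]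

/-- `Hg(X)(ℝ) = SL(V_ℝ) ⟹ dim_ℚ 𝒜 = |ι|² - 1`. [cite: Humphreys1972, §1.2 (`A_ℓ`)] [cite: Hall2015, §3.4 Prop. 3.23] -/
theorem finrank_hodgeGroupLieRat_of_hodgeGroup_eq_top [Nonempty ι] (h : hodgeGroup Φ = ⊤) :
    finrank ℚ (hodgeGroupLieRat Φ) = Fintype.card ι * Fintype.card ι - 1 := by
  rw [hodgeGroupLieRat_eq_sl_of_hodgeGroup_eq_top Φ h, finrank_sl]

end SpecialLinearRat

/-! ## §2 Elliptic curve WITHOUT complex multiplication: `𝒜(E_τ) = 𝔰𝔩₂(ℚ)` -/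

section NonCM

variable {τ : ℂ} (hτ : τ.im ≠ 0)

include hτ in
/-- **`𝒜(E_τ) = 𝔰𝔩₂(ℚ)` for an elliptic curve without complex multiplication** (`End(E_τ) = ℤ`, `Hg(E_τ) = SL₂`).
[cite: Imai1976HodgeGroups, §2 (p. 368: "`Hg(E) = SL₂` if `E` is not of CM-type")] [cite: MoonenZarhin1999, §2 (Type I(1): "`Hg(X) ≅ SL_{2,ℚ}`")] -/
theorem hodgeGroupLieRat_ellipticPeriod_eq_sl_of_eq_bot (h : ellipticEnd hτ = ⊥) :
    hodgeGroupLieRat (ellipticPeriod hτ) = LieAlgebra.SpecialLinear.sl (Fin 2) ℚ :=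
  hodgeGroupLieRat_eq_sl_of_hodgeGroup_eq_top _ ((hodgeGroup_ellipticPeriod_eq_top_iff hτ).2 h)

include hτ in
/-- `A ∈ 𝒜(E_τ) ⟺ tr A = 0` for an elliptic curve without complex multiplication. [cite: Imai1976HodgeGroups, §2 (p. 368)] -/
theorem mem_hodgeGroupLieRat_ellipticPeriod_iff_of_eq_bot (h : ellipticEnd hτ = ⊥) {A : Matrix (Fin 2) (Fin 2) ℚ} :
    A ∈ hodgeGroupLieRat (ellipticPeriod hτ) ↔ A.trace = 0 :=
  mem_hodgeGroupLieRat_iff_trace_eq_zero_of_hodgeGroup_eq_top _ ((hodgeGroup_ellipticPeriod_eq_top_iff hτ).2 h)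

include hτ in
/-- **`dim_ℚ 𝒜(E_τ) = 3`** for an elliptic curve without complex multiplication. [cite: Imai1976HodgeGroups, §2 (p. 368)]
[cite: Humphreys1972, §1.2 (`A₁`: dimension `3`)] -/
theorem finrank_hodgeGroupLieRat_ellipticPeriod_of_eq_bot (h : ellipticEnd hτ = ⊥) :
    finrank ℚ (hodgeGroupLieRat (ellipticPeriod hτ)) = 3 := by
  rw [finrank_hodgeGroupLieRat_of_hodgeGroup_eq_top _ ((hodgeGroup_ellipticPeriod_eq_top_iff hτ).2 h), Fintype.card_fin]

end NonCM

/-! ## §3 Elliptic curve WITH complex multiplication: `𝒜(E_τ) = K⁰ = {a ∈ End⁰(E_τ) | tr a = 0}`, `dim_ℚ = 1` -/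

section CM

variable {τ : ℂ} (hτ : τ.im ≠ 0)

omit hτ in
/-- `tr (A ⊗ 1) = tr A` (again, for this section). [folklore] -/
private theorem trace_map_ratCast₉' {ι : Type*} [Fintype ι] (A : Matrix ι ι ℚ) :
    (A.map ((↑) : ℚ → ℝ)).trace = ((A.trace : ℚ) : ℝ) := by
  simp [Matrix.trace, Matrix.map_apply, Rat.cast_sum]

include hτ in
/-- **`𝒜(E_τ) = K⁰`, THE TRACE-ZERO PART OF THE CM FIELD `K = End⁰(E_τ)`**, for an elliptic curve WITH complex
multiplication: `A ∈ 𝒜 ⟺ A ∈ End⁰(E_τ) ∧ tr A = 0` (`𝔥𝔤_ℝ(E_τ) = ℝ·J`; an endomorphism is `u·1 + v·J` on `V_ℝ`, of trace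
`2u`) — the Lie algebra of the norm-one torus `𝕌_K = Hg(E_τ)`. [cite: Imai1976HodgeGroups, §2 (p. 368: "`Hg(E)` is a 1-dimensional torus if `E` is of CM-type")]
[cite: MoonenZarhin1999, §2 (Type IV(1,1): "`Hg(X) = 𝕌_F`")] [cite: Lange2023AbelianVarietiesComplex, §7.2.3 Prop. 7.2.6 (proof: "`T ⊂ End(V)^{Hg(X)} = End_ℚ(X)`")] -/
theorem mem_hodgeGroupLieRat_ellipticPeriod_iff_of_ne_bot (h : ellipticEnd hτ ≠ ⊥) {A : Matrix (Fin 2) (Fin 2) ℚ} :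
    A ∈ hodgeGroupLieRat (ellipticPeriod hτ) ↔ A ∈ endAlgRat (ellipticPeriod hτ) ∧ A.trace = 0 := by
  constructor
  · intro hA
    refine ⟨(mem_endAlgRat_iff _ A).2 ?_, trace_eq_zero_of_mem_hodgeGroupLieRat hA⟩
    obtain ⟨v, hv⟩ := (mem_hodgeGroupLie_ellipticPeriod_iff_of_ne_bot hτ h).1 ((mem_hodgeGroupLieRat_iff _).1 hA)
    rw [hv, smul_mul_assoc, mul_smul_comm]
  · rintro ⟨hE, htr⟩
    obtain ⟨u, v, huv⟩ :=
      (mul_jMatrix_comm_iff_exists_eq_smul_one_add_smul_jMatrix (ellipticPeriod hτ)).1 ((mem_endAlgRat_iff _ A).1 hE)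
    have ht : (A.map ((↑) : ℚ → ℝ)).trace = 0 := by rw [trace_map_ratCast₉', htr, Rat.cast_zero]
    rw [huv, Matrix.trace_add, Matrix.trace_smul, Matrix.trace_smul, Matrix.trace_one, trace_jMatrix, Fintype.card_fin,
      smul_zero, add_zero, smul_eq_mul] at ht
    have hu : u = 0 := by
      norm_num at ht
      exact ht
    rw [mem_hodgeGroupLieRat_iff, huv, hu, zero_smul, zero_add]
    exact (hodgeGroupLie _).smul_mem v jMatrix_mem_hodgeGroupLie

include hτ in
/-- `𝒜(E_τ) = End⁰(E_τ) ∩ 𝔰𝔩₂(ℚ)` as subsets of `M₂(ℚ)`, for a CM elliptic curve. [cite: Imai1976HodgeGroups, §2 (p. 368)]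
[cite: MoonenZarhin1999, §2 (Type IV(1,1): "`Hg(X) = 𝕌_F`")] -/
theorem coe_hodgeGroupLieRat_ellipticPeriod_eq_of_ne_bot (h : ellipticEnd hτ ≠ ⊥) :
    (hodgeGroupLieRat (ellipticPeriod hτ) : Set (Matrix (Fin 2) (Fin 2) ℚ)) =
      (endAlgRat (ellipticPeriod hτ) : Set (Matrix (Fin 2) (Fin 2) ℚ)) ∩
        (LieAlgebra.SpecialLinear.sl (Fin 2) ℚ : Set (Matrix (Fin 2) (Fin 2) ℚ)) := by
  ext A
  rw [SetLike.mem_coe, mem_hodgeGroupLieRat_ellipticPeriod_iff_of_ne_bot hτ h, Set.mem_inter_iff, SetLike.mem_coe,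
    SetLike.mem_coe, mem_sl_iff_trace_eq_zero]

include hτ in
/-- **`𝒜(E_τ) ⊆ End⁰(E_τ)` for a CM elliptic curve** — the `g = 1` instance of Q2990 §6 «`𝒜 ⊆ End⁰(X)` ⟺ `X` of CM type».
[cite: Lange2023AbelianVarietiesComplex, §7.2.3 Prop. 7.2.6 (proof)] [cite: Imai1976HodgeGroups, §2 (p. 368)] -/
theorem coe_hodgeGroupLieRat_ellipticPeriod_subset_endAlgRat_of_ne_bot (h : ellipticEnd hτ ≠ ⊥) :
    (hodgeGroupLieRat (ellipticPeriod hτ) : Set (Matrix (Fin 2) (Fin 2) ℚ)) ⊆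
      (endAlgRat (ellipticPeriod hτ) : Set (Matrix (Fin 2) (Fin 2) ℚ)) :=
  fun _ hA ↦ ((mem_hodgeGroupLieRat_ellipticPeriod_iff_of_ne_bot hτ h).1 hA).1

include hτ in
/-- **`dim_ℚ 𝒜(E_τ) = 1` for a CM elliptic curve**: `End⁰(E_τ) = 𝒜 ⊕ ℚ·1` (`dim_ℚ End⁰(E_τ) = 2`, and `tr` kills `𝒜`
but not `1`). [cite: Imai1976HodgeGroups, §2 (p. 368: "a 1-dimensional torus")] [cite: Lange2023AbelianVarietiesComplex, §5.1.5 Exercise (1)] -/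
theorem finrank_hodgeGroupLieRat_ellipticPeriod_of_ne_bot (h : ellipticEnd hτ ≠ ⊥) :
    finrank ℚ (hodgeGroupLieRat (ellipticPeriod hτ)) = 1 := by
  set W : Submodule ℚ (Matrix (Fin 2) (Fin 2) ℚ) := (hodgeGroupLieRat (ellipticPeriod hτ)).toSubmodule with hW
  set L : Submodule ℚ (Matrix (Fin 2) (Fin 2) ℚ) := ℚ ∙ (1 : Matrix (Fin 2) (Fin 2) ℚ) with hL
  have hWmem : ∀ A : Matrix (Fin 2) (Fin 2) ℚ, A ∈ W ↔ A ∈ endAlgRat (ellipticPeriod hτ) ∧ A.trace = 0 :=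
    fun A ↦ mem_hodgeGroupLieRat_ellipticPeriod_iff_of_ne_bot hτ h
  -- `W ⊔ ℚ·1 = End⁰(E_τ)`
  have hsup : W ⊔ L = Subalgebra.toSubmodule (endAlgRat (ellipticPeriod hτ)) := by
    refine le_antisymm (sup_le (fun A hA ↦ ((hWmem A).1 hA).1) ?_) fun A hA ↦ ?_
    · rw [hL, Submodule.span_singleton_le_iff_mem]
      exact Subalgebra.one_mem _
    · have hA' : A ∈ endAlgRat (ellipticPeriod hτ) := hA
      set c : ℚ := A.trace / 2 with hc
      have h1 : A - c • (1 : Matrix (Fin 2) (Fin 2) ℚ) ∈ W := by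
        refine (hWmem _).2 ⟨Subalgebra.sub_mem _ hA' (Subalgebra.smul_mem _ (Subalgebra.one_mem _) c), ?_⟩
        rw [Matrix.trace_sub, Matrix.trace_smul, Matrix.trace_one, Fintype.card_fin, smul_eq_mul, hc]
        push_cast
        ring
      have h2 : c • (1 : Matrix (Fin 2) (Fin 2) ℚ) ∈ L := Submodule.mem_span_singleton.2 ⟨c, rfl⟩
      have hsum : A - c • (1 : Matrix (Fin 2) (Fin 2) ℚ) + c • (1 : Matrix (Fin 2) (Fin 2) ℚ) = A := sub_add_cancel A _
      rw [← hsum]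
      exact Submodule.add_mem _ (Submodule.mem_sup_left h1) (Submodule.mem_sup_right h2)
  -- `W ∩ ℚ·1 = 0`
  have hinf : W ⊓ L = ⊥ := by
    refine (Submodule.eq_bot_iff _).2 fun A hA ↦ ?_
    obtain ⟨hAW, hAL⟩ := Submodule.mem_inf.1 hA
    obtain ⟨c, rfl⟩ := Submodule.mem_span_singleton.1 hAL
    have ht := ((hWmem _).1 hAW).2
    rw [Matrix.trace_smul, Matrix.trace_one, Fintype.card_fin, smul_eq_mul] at ht
    have hc : c = 0 := by
      norm_num at ht
      exact ht
    rw [hc, zero_smul]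
  have hdim := Submodule.finrank_sup_add_finrank_inf_eq W L
  rw [hsup, hinf, finrank_bot, add_zero, Subalgebra.finrank_toSubmodule, finrank_endAlgRat_ellipticPeriod_of_cm hτ h, hL,
    finrank_span_singleton (one_ne_zero : (1 : Matrix (Fin 2) (Fin 2) ℚ) ≠ 0)] at hdim
  show finrank ℚ W = 1
  omega

end CM

/-! ## §4 Summary: `dim_ℚ 𝒜(E_τ) = 3` or `1`; `𝒜(E_τ) = 𝔰𝔩₂(ℚ)` iff no CM; `dim_ℚ 𝒜 = dim_ℝ 𝔥𝔤_ℝ` at `g = 1` -/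

section Summary

variable {τ : ℂ} (hτ : τ.im ≠ 0)

include hτ in
/-- `dim_ℚ 𝒜(E_τ) = 3` if `End(E_τ) = ℤ`, `= 1` otherwise. [cite: Imai1976HodgeGroups, §2 (p. 368)] -/
theorem finrank_hodgeGroupLieRat_ellipticPeriod_eq [Decidable (ellipticEnd hτ = ⊥)] :
    finrank ℚ (hodgeGroupLieRat (ellipticPeriod hτ)) = if ellipticEnd hτ = ⊥ then 3 else 1 := by
  split_ifs with h
  · exact finrank_hodgeGroupLieRat_ellipticPeriod_of_eq_bot hτ h
  · exact finrank_hodgeGroupLieRat_ellipticPeriod_of_ne_bot hτ h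

include hτ in
/-- **`𝒜(E_τ) = 𝔰𝔩₂(ℚ)` IFF `E_τ` HAS NO COMPLEX MULTIPLICATION** (dimension `3` versus `1`).
[cite: Imai1976HodgeGroups, §2 (p. 368)] [cite: MoonenZarhin1999, §2 (Types I(1) and IV(1,1))] -/
theorem hodgeGroupLieRat_ellipticPeriod_eq_sl_iff :
    hodgeGroupLieRat (ellipticPeriod hτ) = LieAlgebra.SpecialLinear.sl (Fin 2) ℚ ↔ ellipticEnd hτ = ⊥ := by
  refine ⟨fun hsl ↦ ?_, hodgeGroupLieRat_ellipticPeriod_eq_sl_of_eq_bot hτ⟩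
  by_contra hcm
  have h1 := finrank_hodgeGroupLieRat_ellipticPeriod_of_ne_bot hτ hcm
  rw [hsl, finrank_sl, Fintype.card_fin] at h1
  norm_num at h1

include hτ in
/-- `dim_ℚ 𝒜(E_τ) = dim_ℝ 𝔥𝔤_ℝ(E_τ)` — GGK's «`𝒜_ℝ = 𝒜 ⊗ ℝ`» at `g = 1`, by the two explicit computations (p17's
`finrank_hodgeGroupLie_ellipticPeriod_eq`). [cite: GreenGriffithsKerr2012, §II.C, Lemma after (II.C.1)] [cite: Imai1976HodgeGroups, §2 (p. 368)] -/
theorem finrank_hodgeGroupLieRat_ellipticPeriod_eq_finrank_hodgeGroupLie :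
    finrank ℚ (hodgeGroupLieRat (ellipticPeriod hτ)) = finrank ℝ (hodgeGroupLie (ellipticPeriod hτ)) := by
  classical
  rw [finrank_hodgeGroupLieRat_ellipticPeriod_eq hτ, finrank_hodgeGroupLie_ellipticPeriod_eq hτ]

end Summary

end ComplexTorus

end Literature.Geometry.Kaehler
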